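import Summits.AtomisticToContinuum.Crystallization.Theorems.ChargedEnergyGapIsoKernel
import Summits.AtomisticToContinuum.Crystallization.Theorems.ChargedEnergyGapFarSourceKernel
import HarnessLib

/-!
# Charged energy gap — lens-3 g65, node «BarlowRef» (R3) — part 22b (addendum; imports parts 19, 22a): the FAR-SOURCE TAIL in closed form

The sum over ALL far sources of part 22a's per-source kernel, the record value, and the share in the currency of the ruled statistic
(critic rows 1215/1224: «no truncation anywhere»; «S survives iff the typed tail < ≈ 0.14 per level»):

* `shellCore`, ★ `source_shell_sum_mul_le`: `(Σ_{y ∈ F} (dist y c − r)⁻⁵) · V ≤ π · shellCore A r p` for far sources `F ⊆` image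
  (`dist y c ≥ A ≥ r + 18/5`), by the geometric source shells `[A pⁿ, A pⁿ⁺¹)` — EVERY far source lies in one (`exists_nat_pow_near`) —
  each counted with part 19 `card_mul_le_shell_of_subset_image` (`#·V ≤ (4π/3)((Apⁿ⁺¹ + 9/5)³ − (Apⁿ − 9/5)³) ≤ (4π/3)((pA + 9/5)³ − (A − 9/5)³)·p³ⁿ`)
  and weighted by `((A − r)pⁿ)⁻⁵`; geometric series `1/(1 − p⁻²)`;
* ★★ `far_sources_sum_mul_le` = `tubeLoad_far_mul_sq_le`: `tubeLoad r c F G · V² ≤ farPsi r (A − r) q K · (π · shellCore A r p)`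
  for far sources `F` and ANY finite image targets `G`;
* RECORD (`r = 101/5`, `A = 400`, `p = q = 11/10`, `K = 40`): `shellCore_record_le` (`≤ 2.2451·10⁻⁵`), `far_tail_record_le`
  (`farPsi · π·shellCore ≤ 3.1416² · 258.2 · 2.2451·10⁻⁵ ≤ 3/50`), ★★ `tubeLoad_far_record_le`: `tubeLoad (101/5) c F G · V² ≤ 3/50`;
* the statistic's currency: `le_window_cell_volume` (`V ≥ 0.463`), ★★ `exists_finset_closedBall_sameV` (part 5's ball count with the SAME
  `V`: `(4π/3)(R − 9/5)³ ≤ #T · V`, `T ⊆ image ∩ B̄(q,R)`), ★★ `tubeLoad_far_record_share`: `tubeLoad (101/5) c F G ≤ N/136000` whenever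
  `(4π/3)(18 − 9/5)³ ≤ N · V` — i.e. `≤ (2100/136000) · B_T · N ≤ 0.0155 · B_T · N` with `B_T = 1/2100`.

PRINT (num/far22.py, deterministic, exact rationals, `3.14 < π < 3.1416`): `farPsi = 810.98`, `π·shellCore = 7.053·10⁻⁵`, product `0.0572`;
certified far-source tail (sources `a ≥ 400`) in statistic units `≤ 0.0154 × B_T × N` per member at EVERY member level `155.5, …, 159.5`
(level-independent; cert65's numeric slice `a ∈ (400, 2·10⁴]` was `0.010–0.013`).  Ruled statistic with the typed tail: `0.348 + 0.0154 = 0.363 < 1/2`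
(replacing cert65's numeric `(400, 2·10⁴]` slice by the closed form: `≈ 0.352`) — S SURVIVES.
0 sorry; standard axioms.
-/

noncomputable section

open scoped Classical RealInnerProductSpace
open Literature.MathematicalPhysics.StatisticalMechanics Literature.Geometry.DiscreteGeometry
open Summit.AtomisticToContinuum.Crystallization.Theses.PricedLinkCensus
open Summit.AtomisticToContinuum.Crystallization.Theorems.ChargedEnergyGapNegative

namespace Summit.AtomisticToContinuum.Crystallization.Theorems.ChargedEnergyGapChartDial

section FarSourceTail

/-- The rational core of the SOURCE-SHELL constant: geometric shells `[A pⁿ, A pⁿ⁺¹)` of far sources, weight `(A − r)⁻⁵ p⁻⁵ⁿ`,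
count `(4π/3)((pA + 9/5)³ − (A − 9/5)³)·p³ⁿ / V`. -/
def shellCore (A r p : ℝ) : ℝ :=
  4 / 3 * ((p * A + 9 / 5) ^ 3 - (A - 9 / 5) ^ 3) / ((A - r) ^ 5 * (1 - (p⁻¹) ^ 2))

/-- `shellCore ≥ 0` (`A ≥ 9/5`, `r < A`, `p > 1`). -/
theorem shellCore_nonneg {A r p : ℝ} (hA : 9 / 5 ≤ A) (hrA : r < A) (hp : 1 < p) : 0 ≤ shellCore A r p := by
  obtain ⟨h20, h21⟩ := inv_pow_ratio_lt_one hp (m := 2) (by norm_num)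
  have h1 : 0 < 1 - (p⁻¹) ^ 2 := by linarith
  have h2 : 0 ≤ (p * A + 9 / 5) ^ 3 - (A - 9 / 5) ^ 3 := by
    have h3 : A - 9 / 5 ≤ p * A + 9 / 5 := by nlinarith
    have := pow_le_pow_left₀ (by linarith : 0 ≤ A - 9 / 5) h3 3
    linarith
  have h4 : 0 < A - r := by linarith
  unfold shellCore
  positivity

/-- ★ THE SOURCE SHELLS (closed form, no truncation).  For far sources `F ⊆` image with `A ≤ dist y c` (`r + 18/5 ≤ A`, `r ≥ 0`)
and any ratio `p > 1`:  `(Σ_{y ∈ F} (dist y c − r)⁻⁵) · a(a√3/2)h ≤ π · shellCore A r p`. -/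
theorem source_shell_sum_mul_le {a h : ℝ} {s : ℤ → ℤ} {g : E3 → E3}
    (ha : 9 / 10 ≤ a ∧ a ≤ 11 / 10) (hh : 0 < h ∧ 27 / 50 * a ^ 2 ≤ h ^ 2 ∧ h ^ 2 ≤ 121 / 150 * a ^ 2) (hg : Isometry g)
    (c : E3) {r A p : ℝ} (hr : 0 ≤ r) (hA : r + 18 / 5 ≤ A) (hp : 1 < p)
    (F : Finset E3) (hF : ↑F ⊆ g '' barlowStacking a h s) (hFA : ∀ y ∈ F, A ≤ dist y c) :
    (∑ y ∈ F, (dist y c - r)⁻¹ ^ 5) * (a * (a * √3 / 2) * h) ≤ Real.pi * shellCore A r p := by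
  have ha0 : 0 ≤ a := by linarith [ha.1]
  have hV0 : 0 ≤ a * (a * √3 / 2) * h := by have := hh.1.le; positivity
  have hA0 : 0 < A := by linarith
  have hAr : 0 < A - r := by linarith
  have hp0 : 0 < p := one_pos.trans hp
  have hp1 : 1 ≤ p := hp.le
  -- the shell index of a source
  have hex : ∀ y ∈ F, ∃ n : ℕ, A * p ^ n ≤ dist y c ∧ dist y c < A * p ^ (n + 1) := by
    intro y hy
    have h1 : 1 ≤ dist y c / A := by rw [le_div_iff₀ hA0, one_mul]; exact hFA y hy
    obtain ⟨n, hn1, hn2⟩ := exists_nat_pow_near h1 hp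
    refine ⟨n, ?_, ?_⟩
    · have := (le_div_iff₀ hA0).1 hn1; linarith [this]
    · have := (div_lt_iff₀ hA0).1 hn2; linarith [this]
  let nOf : E3 → ℕ := fun y => if hy : y ∈ F then (hex y hy).choose else 0
  have hnOf : ∀ y ∈ F, A * p ^ nOf y ≤ dist y c ∧ dist y c < A * p ^ (nOf y + 1) := by
    intro y hy
    have e : nOf y = (hex y hy).choose := dif_pos hy
    rw [e]
    exact (hex y hy).choose_spec
  set S : Finset ℕ := F.image nOf with hS
  obtain ⟨N, hN⟩ := Finset.exists_nat_subset_range S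
  have hfib : ∑ y ∈ F, (dist y c - r)⁻¹ ^ 5 = ∑ n ∈ S, ∑ y ∈ F with nOf y = n, (dist y c - r)⁻¹ ^ 5 :=
    (Finset.sum_fiberwise_of_maps_to (fun y hy => Finset.mem_image_of_mem nOf hy) _).symm
  -- one shell
  set D := 4 * Real.pi / 3 * ((p * A + 9 / 5) ^ 3 - (A - 9 / 5) ^ 3) / (A - r) ^ 5 with hD
  have hΔ : 0 ≤ (p * A + 9 / 5) ^ 3 - (A - 9 / 5) ^ 3 := by
    have h3 : A - 9 / 5 ≤ p * A + 9 / 5 := by nlinarith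
    have := pow_le_pow_left₀ (by linarith : 0 ≤ A - 9 / 5) h3 3
    linarith
  have hD0 : 0 ≤ D := by positivity
  have hshell : ∀ n ∈ S, (∑ y ∈ F with nOf y = n, (dist y c - r)⁻¹ ^ 5) * (a * (a * √3 / 2) * h) ≤ D * ((p⁻¹) ^ 2) ^ n := by
    intro n _
    have hpn : 1 ≤ p ^ n := one_le_pow₀ hp1
    have hpn0 : 0 < p ^ n := by positivity
    set Fn := F.filter (fun y => nOf y = n) with hFn
    have hFnF : Fn ⊆ F := Finset.filter_subset _ _
    have hmem : ∀ y ∈ Fn, A * p ^ n ≤ dist y c ∧ dist y c < A * p ^ (n + 1) := by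
      intro y hy
      rw [hFn, Finset.mem_filter] at hy
      have := hnOf y hy.1
      rw [hy.2] at this
      exact this
    -- count
    have hR1 : 9 / 5 ≤ A * p ^ n := by nlinarith
    have hR12 : A * p ^ n ≤ A * p ^ (n + 1) := by rw [pow_succ]; nlinarith
    have hcount := card_mul_le_shell_of_subset_image ha hh hg c hR1 hR12 Fn
      (subset_trans (Finset.coe_subset.2 hFnF) hF) (fun y hy => (hmem y hy).1) (fun y hy => (hmem y hy).2.le)
    -- weight
    have hw0 : 0 < (A - r) * p ^ n := by positivity
    have hw : ∀ y ∈ Fn, (dist y c - r)⁻¹ ^ 5 ≤ ((A - r) * p ^ n)⁻¹ ^ 5 := by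
      intro y hy
      have h1 := (hmem y hy).1
      have hle : (A - r) * p ^ n ≤ dist y c - r := by nlinarith
      exact pow_le_pow_left₀ (inv_nonneg.2 (hw0.le.trans hle)) (inv_anti₀ hw0 hle) 5
    have hsumw : ∑ y ∈ Fn, (dist y c - r)⁻¹ ^ 5 ≤ Fn.card * ((A - r) * p ^ n)⁻¹ ^ 5 := by
      have := Finset.sum_le_sum hw
      rwa [Finset.sum_const, nsmul_eq_mul] at this
    -- the shell volume scales like `p³ⁿ`
    have hvol : (A * p ^ (n + 1) + 9 / 5) ^ 3 - (A * p ^ n - 9 / 5) ^ 3 ≤ ((p * A + 9 / 5) ^ 3 - (A - 9 / 5) ^ 3) * (p ^ n) ^ 3 := by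
      have e1 : A * p ^ (n + 1) + 9 / 5 ≤ (p * A + 9 / 5) * p ^ n := by rw [pow_succ]; nlinarith
      have e2 : (A - 9 / 5) * p ^ n ≤ A * p ^ n - 9 / 5 := by nlinarith
      have e10 : 0 ≤ A * p ^ (n + 1) + 9 / 5 := by positivity
      have hA95 : 0 ≤ A - 9 / 5 := by linarith
      have e20 : 0 ≤ (A - 9 / 5) * p ^ n := by positivity
      have c1 := pow_le_pow_left₀ e10 e1 3
      have c2 := pow_le_pow_left₀ e20 e2 3
      rw [mul_pow] at c1 c2
      linarith
    calc (∑ y ∈ Fn, (dist y c - r)⁻¹ ^ 5) * (a * (a * √3 / 2) * h)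
        ≤ Fn.card * ((A - r) * p ^ n)⁻¹ ^ 5 * (a * (a * √3 / 2) * h) := mul_le_mul_of_nonneg_right hsumw hV0
      _ = Fn.card * (a * (a * √3 / 2) * h) * ((A - r) * p ^ n)⁻¹ ^ 5 := by ring
      _ ≤ 4 * Real.pi / 3 * ((A * p ^ (n + 1) + 9 / 5) ^ 3 - (A * p ^ n - 9 / 5) ^ 3) * ((A - r) * p ^ n)⁻¹ ^ 5 :=
          mul_le_mul_of_nonneg_right hcount (by positivity)
      _ ≤ 4 * Real.pi / 3 * (((p * A + 9 / 5) ^ 3 - (A - 9 / 5) ^ 3) * (p ^ n) ^ 3) * ((A - r) * p ^ n)⁻¹ ^ 5 := by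
          have h43 : 0 ≤ 4 * Real.pi / 3 := by positivity
          exact mul_le_mul_of_nonneg_right (mul_le_mul_of_nonneg_left hvol h43) (by positivity)
      _ = D * ((p⁻¹) ^ 2) ^ n := by
          rw [hD, ← pow_mul, inv_pow, mul_pow, inv_pow, inv_pow]
          field_simp
          ring
  -- sum over the shells
  have hgeom := geom_sum_inv_pow_le hp (m := 2) (by norm_num) N
  calc (∑ y ∈ F, (dist y c - r)⁻¹ ^ 5) * (a * (a * √3 / 2) * h)
      = ∑ n ∈ S, (∑ y ∈ F with nOf y = n, (dist y c - r)⁻¹ ^ 5) * (a * (a * √3 / 2) * h) := by rw [hfib, Finset.sum_mul]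
    _ ≤ ∑ n ∈ S, D * ((p⁻¹) ^ 2) ^ n := Finset.sum_le_sum hshell
    _ ≤ ∑ n ∈ Finset.range N, D * ((p⁻¹) ^ 2) ^ n :=
        Finset.sum_le_sum_of_subset_of_nonneg hN fun n _ _ => by positivity
    _ = D * ∑ n ∈ Finset.range N, ((p⁻¹) ^ 2) ^ n := by rw [Finset.mul_sum]
    _ ≤ D * (1 / (1 - (p⁻¹) ^ 2)) := mul_le_mul_of_nonneg_left hgeom hD0
    _ = Real.pi * shellCore A r p := by
        rw [hD]
        unfold shellCore
        have h1 : 0 < 1 - (p⁻¹) ^ 2 := by have := (inv_pow_ratio_lt_one hp (m := 2) (by norm_num)).2; linarith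
        field_simp

/-- ★★ THE FAR-SOURCE TAIL (double sum, closed form, no truncation).  For far sources `F ⊆` image (`A ≤ dist y c`, `r + 18/5 ≤ A`),
any finite targets `T ⊆` image, ratios `p, q > 1` and depth `K`:
`(Σ_{y ∈ F} Σ_{z ∈ T} [y ≠ z ∧ infDist c [y,z] ≤ r]·(dist y z)⁻⁶) · V² ≤ farPsi r (A − r) q K · (π · shellCore A r p)`. -/
theorem far_sources_sum_mul_le {a h : ℝ} {s : ℤ → ℤ} {g : E3 → E3}
    (ha : 9 / 10 ≤ a ∧ a ≤ 11 / 10) (hh : 0 < h ∧ 27 / 50 * a ^ 2 ≤ h ^ 2 ∧ h ^ 2 ≤ 121 / 150 * a ^ 2) (hg : Isometry g)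
    (c : E3) {r A p q : ℝ} (K : ℕ) (hr : 0 ≤ r) (hA : r + 18 / 5 ≤ A) (hp : 1 < p) (hq : 1 < q)
    (F : Finset E3) (hF : ↑F ⊆ g '' barlowStacking a h s) (hFA : ∀ y ∈ F, A ≤ dist y c)
    (T : Finset E3) (hT : ↑T ⊆ g '' barlowStacking a h s) :
    (∑ y ∈ F, ∑ z ∈ T, if y ≠ z ∧ Metric.infDist c (segment ℝ y z) ≤ r then (dist y z)⁻¹ ^ 6 else 0) *
        (a * (a * √3 / 2) * h) ^ 2 ≤ farPsi r (A - r) q K * (Real.pi * shellCore A r p) := by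
  have ha0 : 0 ≤ a := by linarith [ha.1]
  have hV0 : 0 ≤ a * (a * √3 / 2) * h := by have := hh.1.le; positivity
  have hX : 18 / 5 ≤ A - r := by linarith
  have hPsi0 : 0 ≤ farPsi r (A - r) q K := farPsi_nonneg K hr (by linarith) hq
  have h1 : ∀ y ∈ F, (∑ z ∈ T, if y ≠ z ∧ Metric.infDist c (segment ℝ y z) ≤ r then (dist y z)⁻¹ ^ 6 else 0) *
      (a * (a * √3 / 2) * h) ≤ farPsi r (A - r) q K * (dist y c - r)⁻¹ ^ 5 := fun y hy =>
    far_source_kernel_mul_le ha hh hg K hr hX hq (by linarith [hFA y hy]) T hT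
  have h2 := source_shell_sum_mul_le ha hh hg c hr hA hp F hF hFA
  calc (∑ y ∈ F, ∑ z ∈ T, if y ≠ z ∧ Metric.infDist c (segment ℝ y z) ≤ r then (dist y z)⁻¹ ^ 6 else 0) *
        (a * (a * √3 / 2) * h) ^ 2
      = ∑ y ∈ F, (∑ z ∈ T, if y ≠ z ∧ Metric.infDist c (segment ℝ y z) ≤ r then (dist y z)⁻¹ ^ 6 else 0) *
          (a * (a * √3 / 2) * h) * (a * (a * √3 / 2) * h) := by rw [sq, ← mul_assoc, Finset.sum_mul, Finset.sum_mul]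
    _ ≤ ∑ y ∈ F, farPsi r (A - r) q K * (dist y c - r)⁻¹ ^ 5 * (a * (a * √3 / 2) * h) :=
        Finset.sum_le_sum fun y hy => mul_le_mul_of_nonneg_right (h1 y hy) hV0
    _ = farPsi r (A - r) q K * ((∑ y ∈ F, (dist y c - r)⁻¹ ^ 5) * (a * (a * √3 / 2) * h)) := by
        rw [Finset.sum_mul, Finset.mul_sum]
        refine Finset.sum_congr rfl fun y _ => ?_
        ring
    _ ≤ farPsi r (A - r) q K * (Real.pi * shellCore A r p) := mul_le_mul_of_nonneg_left h2 hPsi0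

/-- ★★ The same in the `tubeLoad` currency of `TubeShareBoundH` (§R6 of `…BarlowResidual`): the load of the FAR sources. -/
theorem tubeLoad_far_mul_sq_le {a h : ℝ} {s : ℤ → ℤ} {g : E3 → E3}
    (ha : 9 / 10 ≤ a ∧ a ≤ 11 / 10) (hh : 0 < h ∧ 27 / 50 * a ^ 2 ≤ h ^ 2 ∧ h ^ 2 ≤ 121 / 150 * a ^ 2) (hg : Isometry g)
    (c : E3) {r A p q : ℝ} (K : ℕ) (hr : 0 ≤ r) (hA : r + 18 / 5 ≤ A) (hp : 1 < p) (hq : 1 < q)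
    (F : Finset E3) (hF : ↑F ⊆ g '' barlowStacking a h s) (hFA : ∀ y ∈ F, A ≤ dist y c)
    (G : Finset E3) (hG : ↑G ⊆ g '' barlowStacking a h s) :
    tubeLoad r c F G * (a * (a * √3 / 2) * h) ^ 2 ≤ farPsi r (A - r) q K * (Real.pi * shellCore A r p) :=
  far_sources_sum_mul_le ha hh hg c K hr hA hp hq F hF hFA G hG

/-- RECORD CONSTANTS: `shellCore 400 (101/5) (11/10) ≤ 2.2451·10⁻⁵` (`π·shellCore ≤ 7.06·10⁻⁵`). -/
theorem shellCore_record_le : shellCore 400 (101 / 5) (11 / 10) ≤ 22451 / 1000000000 := by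
  unfold shellCore
  norm_num

/-- ★★ RECORD FAR TAIL: `farPsi (101/5) (1899/5) (11/10) 40 · (π · shellCore 400 (101/5) (11/10)) ≤ 3/50` (`≈ 0.0572`; `π < 3.1416`). -/
theorem far_tail_record_le :
    farPsi (101 / 5) (1899 / 5) (11 / 10) 40 * (Real.pi * shellCore 400 (101 / 5) (11 / 10)) ≤ 3 / 50 := by
  have hπ := Real.pi_lt_d4
  have hπ0 := Real.pi_pos.le
  have hπ2 : Real.pi ^ 2 ≤ 3.1416 ^ 2 := pow_le_pow_left₀ hπ0 hπ.le 2
  have hc1 := farPsiCore_record_le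
  have hc2 := shellCore_record_le
  have hc10 : 0 ≤ farPsiCore (101 / 5) (1899 / 5) (11 / 10) 40 := farPsiCore_nonneg 40 (by norm_num) (by norm_num) (by norm_num)
  have hc20 : 0 ≤ shellCore 400 (101 / 5) (11 / 10) := shellCore_nonneg (by norm_num) (by norm_num) (by norm_num)
  calc farPsi (101 / 5) (1899 / 5) (11 / 10) 40 * (Real.pi * shellCore 400 (101 / 5) (11 / 10))
      = Real.pi ^ 2 * (farPsiCore (101 / 5) (1899 / 5) (11 / 10) 40 * shellCore 400 (101 / 5) (11 / 10)) := by
        unfold farPsi; ring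
    _ ≤ (3.1416 : ℝ) ^ 2 * (2582 / 10 * (22451 / 1000000000)) :=
        mul_le_mul hπ2 (mul_le_mul hc1 hc2 hc20 (by norm_num)) (by positivity) (by positivity)
    _ ≤ 3 / 50 := by norm_num

/-- ★★ RECORD, `tubeLoad` currency: for image sources `F` beyond `400` from the tube centre and any image targets `G`,
`tubeLoad (101/5) c F G · V² ≤ 3/50`. -/
theorem tubeLoad_far_record_le {a h : ℝ} {s : ℤ → ℤ} {g : E3 → E3}
    (ha : 9 / 10 ≤ a ∧ a ≤ 11 / 10) (hh : 0 < h ∧ 27 / 50 * a ^ 2 ≤ h ^ 2 ∧ h ^ 2 ≤ 121 / 150 * a ^ 2) (hg : Isometry g)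
    (c : E3) (F : Finset E3) (hF : ↑F ⊆ g '' barlowStacking a h s) (hFA : ∀ y ∈ F, 400 ≤ dist y c)
    (G : Finset E3) (hG : ↑G ⊆ g '' barlowStacking a h s) :
    tubeLoad (101 / 5) c F G * (a * (a * √3 / 2) * h) ^ 2 ≤ 3 / 50 := by
  have h1 := tubeLoad_far_mul_sq_le ha hh hg c (r := 101 / 5) (A := 400) (p := 11 / 10) (q := 11 / 10) 40
    (by norm_num) (by norm_num) (by norm_num) (by norm_num) F hF hFA G hG
  have e : (400 : ℝ) - 101 / 5 = 1899 / 5 := by norm_num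
  rw [e] at h1
  exact h1.trans far_tail_record_le

/-- WINDOW ARITHMETIC (iii): the cell volume is `≥ 0.463` (`a ≥ 9/10`, `h² ≥ 27a²/50`; the dense corner `V = 0.46393…`). -/
theorem le_window_cell_volume {a h : ℝ} (ha : 9 / 10 ≤ a ∧ a ≤ 11 / 10) (hh : 0 < h ∧ 27 / 50 * a ^ 2 ≤ h ^ 2 ∧ h ^ 2 ≤ 121 / 150 * a ^ 2) :
    463 / 1000 ≤ a * (a * √3 / 2) * h := by
  have h3 : (√3 : ℝ) ^ 2 = 3 := Real.sq_sqrt (by norm_num)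
  have ha0 : 0 ≤ a := by linarith [ha.1]
  have hV0 : 0 ≤ a * (a * √3 / 2) * h := by have := hh.1.le; positivity
  have ha2 : 81 / 100 ≤ a ^ 2 := by nlinarith [ha.1, ha.2]
  have ha4 : (81 / 100) ^ 2 ≤ a ^ 4 := by nlinarith
  have hh2 : 27 / 50 * (81 / 100) ≤ h ^ 2 := by nlinarith [hh.2.1]
  have ha6 : (81 / 100) ^ 2 * (27 / 50 * (81 / 100)) ≤ a ^ 4 * h ^ 2 := mul_le_mul ha4 hh2 (by norm_num) (by positivity)
  have hsq : (463 / 1000 : ℝ) ^ 2 ≤ (a * (a * √3 / 2) * h) ^ 2 := by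
    rw [show (a * (a * √3 / 2) * h) ^ 2 = a ^ 4 * h ^ 2 * (√3 ^ 2) / 4 by ring, h3]
    nlinarith
  exact (pow_le_pow_iff_left₀ (by norm_num) hV0 two_ne_zero).1 hsq

/-- ★★ SAME-V BALL COUNT in coordinates (part 5's `IsBarlowImage.exists_finset_closedBall` before the window bound `V ≤ 1.036` is
applied): for `q` in the image and `R ≥ 9/5` there is a finite `T ⊆ image ∩ B̄(q,R)` with `(4π/3)(R − 9/5)³ ≤ #T · a(a√3/2)h` —
the SAME cell volume as in the kernel bounds above, so that `V` cancels in the shares. -/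
theorem exists_finset_closedBall_sameV {a h : ℝ} {s : ℤ → ℤ} {g : E3 → E3}
    (ha : 9 / 10 ≤ a ∧ a ≤ 11 / 10) (hh : 0 < h ∧ 27 / 50 * a ^ 2 ≤ h ^ 2 ∧ h ^ 2 ≤ 121 / 150 * a ^ 2) (hg : Isometry g)
    {q : E3} (hq : q ∈ g '' barlowStacking a h s) {R : ℝ} (hR : 9 / 5 ≤ R) :
    ∃ T : Finset E3, ↑T ⊆ g '' barlowStacking a h s ∩ Metric.closedBall q R ∧
      4 * Real.pi / 3 * (R - 9 / 5) ^ 3 ≤ (T.card : ℝ) * (a * (a * √3 / 2) * h) := by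
  obtain ⟨x₀, hx₀, rfl⟩ := hq
  have ha0 : 0 < a := by linarith [ha.1]
  obtain ⟨I, hI⟩ := exists_index_finset a h s ha0 hh.1 x₀ R
  let bp : ℤ × ℤ × ℤ → E3 := fun t => barlowPos a h s t.1 t.2.1 t.2.2
  have hinj : Function.Injective (g ∘ bp) := hg.injective.comp (barlowPos_triple_injective ha0 hh.1)
  refine ⟨I.image (g ∘ bp), ?_, ?_⟩
  · intro p hp
    obtain ⟨t, ht, rfl⟩ := Finset.mem_image.1 (Finset.mem_coe.1 hp)
    refine ⟨⟨bp t, ⟨t.1, t.2.1, t.2.2, rfl⟩, rfl⟩, ?_⟩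
    rw [Metric.mem_closedBall, Function.comp_apply, hg.dist_eq]
    exact (hI t).1 ht
  · rw [Finset.card_image_of_injective _ hinj]
    exact ball_volume_le_card_mul a h s ha0 hh.1 (by norm_num) (window_brick_diag ha hh) x₀ hR I (fun t ht => (hI t).2 ht)

/-- ★★ RECORD, STATISTIC currency: for image sources beyond `400` and any image targets, `tubeLoad (101/5) c F G ≤ N/136000` for every
real `N` with `(4π/3)(18 − 9/5)³ ≤ N · V` — in particular for `N = #(S ∩ B̄(q,18))` (`exists_finset_closedBall_sameV`).  In the units of
the ruled statistic (`× B_T × N`, `B_T = 1/2100`): `2100/136000 ≤ 0.0155` per member, level-independent. -/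
theorem tubeLoad_far_record_share {a h : ℝ} {s : ℤ → ℤ} {g : E3 → E3}
    (ha : 9 / 10 ≤ a ∧ a ≤ 11 / 10) (hh : 0 < h ∧ 27 / 50 * a ^ 2 ≤ h ^ 2 ∧ h ^ 2 ≤ 121 / 150 * a ^ 2) (hg : Isometry g)
    (c : E3) (F : Finset E3) (hF : ↑F ⊆ g '' barlowStacking a h s) (hFA : ∀ y ∈ F, 400 ≤ dist y c)
    (G : Finset E3) (hG : ↑G ⊆ g '' barlowStacking a h s)
    {N : ℝ} (hN : 4 * Real.pi / 3 * (18 - 9 / 5) ^ 3 ≤ N * (a * (a * √3 / 2) * h)) :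
    tubeLoad (101 / 5) c F G ≤ N / 136000 := by
  set V := a * (a * √3 / 2) * h with hV
  have h1 := tubeLoad_far_record_le ha hh hg c F hF hFA G hG
  have hVl := le_window_cell_volume ha hh
  have hV0 : 0 < V := by rw [hV]; linarith
  have hNV : 17799 ≤ N * V := by nlinarith [Real.pi_gt_d2]
  have hN0 : 0 ≤ N := by
    by_contra hneg
    rw [not_le] at hneg
    nlinarith
  have hL0 : 0 ≤ tubeLoad (101 / 5) c F G := by
    unfold tubeLoad
    exact Finset.sum_nonneg fun y _ => Finset.sum_nonneg fun z _ => by split_ifs <;> positivity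
  rw [le_div_iff₀ (by norm_num : (0 : ℝ) < 136000)]
  have key : tubeLoad (101 / 5) c F G * 136000 * V ^ 2 ≤ N * V ^ 2 := by
    have h2 : 17799 * (463 / 1000) ≤ N * V * V := mul_le_mul hNV hVl (by norm_num) (by positivity)
    nlinarith
  exact le_of_mul_le_mul_right key (by positivity)


end FarSourceTail

end Summit.AtomisticToContinuum.Crystallization.Theorems.ChargedEnergyGapChartDial

end
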